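import Summits.KontsevichZagierPeriods.KontsevichZagierPeriods.Theorems.UnfoldedStokesStokesGenerationFibrewiseRungAngSwap
import Summits.KontsevichZagierPeriods.KontsevichZagierPeriods.Theorems.UnfoldedStokesStokesGenerationStubPlaceCoords
import Summits.KontsevichZagierPeriods.KontsevichZagierPeriods.Theorems.UnfoldedStokesStokesGenerationStubExactSwap
import Summits.KontsevichZagierPeriods.KontsevichZagierPeriods.Theorems.UnfoldedStokesStokesGenerationStubValueOneCoord
import Summits.KontsevichZagierPeriods.KontsevichZagierPeriods.Theorems.UnfoldedStokesStokesGenerationStubZsmulSumCube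
import Summits.KontsevichZagierPeriods.KontsevichZagierPeriods.Theorems.UnfoldedStokesStokesGenerationLineReduction
import Literature.NumberTheory.Transcendental.KZLogCalculusProofs

/-!
# `StokesGeneration` (stmt-KontsevichZagierPeriods-3586), line `fibrewise_stokes` — rung 9c/d/e: separated variables (THEOREM D) and the kernel conjecture on the separated-rational cube sub-calculus

Crux `Summit.KontsevichZagierPeriods.KontsevichZagierPeriods.Theses.UnfoldedStokes.StokesGeneration` (kernel-checked equivalent to
the summit); residual S2 = `FibrewiseStokesGenerationConjecture`. Rung 9, second half (lead c5):
* `fibStokesDecomposable_ratSwap` — the transposition `R(x₀) − R(x₁)` of EVERY `K`-rational `R = P/Q` (`K = algebraicClosure ℚ ℝ`,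
  `Q` zero-free on `[0,1]`) is decomposable on the square, with NO value hypothesis and no Baker: mixed form
  (`exists_mixedForm_ratAlgK`, p131637), exact transposition (`stub_exactSwap`, p131617), dlog transpositions (rung 6 with `q = p`,
  p128879), angular transpositions (rung 9b);
* THEOREM D `fibStokesDecomposable_separatedRat` — S2 for every SEPARATED-VARIABLES rational integrand `Σⱼ γⱼ Rⱼ(x_{aⱼ})` on
  `[0,1]^N` of value `0`: transpose every `Rⱼ` to a home coordinate (placed by `stub_placeCoords`, p131599), the remainder
  `(Σⱼ γⱼ Rⱼ)(x_home)` is ONE `K`-rational function of one coordinate (`exists_ratFun_sum`) whose value is the total value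
  (`stub_valueOneCoord`, p131634), decomposable by rung 8 (`fibStokesDecomposable_ratAlgK`). Genuinely `N`-dimensional, Baker-complete;
* kernel forms: `of_mem_relations_separatedRat` (one representation) and
  `mem_relations_of_eval_eq_zero_separatedRat` — **the Kontsevich–Zagier kernel conjecture holds on the subgroup of `FormalRep`
  generated by closed-cube representations of all dimensions with separated-variables `K`-rational integrands**: lift to a common
  dimension (`exists_liftCube`), merge by integrand additivity (`stub_zsmulSumCube`, p132269), THEOREM D. An unconditional instance of
  the crux in every dimension.

References: M. Kontsevich, D. Zagier, *Periods* (2001), §1.2 rule (2) and Conjecture 1; J. Ayoub, Ann. of Math. 181 (2015),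
Conj. 1.1, Rem. 1.5; J. Fresán, *Une introduction aux périodes* (2024), Rem. 3.7; A. Baker, *Transcendental Number Theory* (1975), Thm. 2.1.
-/

noncomputable section

set_option linter.dupNamespace false

namespace Summit.KontsevichZagierPeriods.KontsevichZagierPeriods.Cruxes.StokesGeneration.FibrewiseStokes

open MeasureTheory Set
open Literature.NumberTheory.Transcendental
open Literature.NumberTheory.Transcendental.KZ
open Literature.ModelTheory.ExponentialFields (IsSemialgebraic)

open scoped Polynomial
open Summit.KontsevichZagierPeriods.HurwitzMicroSectors.NormalFormPrinciple.PiBox.AlgSplitK5 (isAlgebraic_coeK)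

section General

/-! ## Rung 9c: the rational self-transposition over the real algebraic numbers -/

/-- **A closed-cube representation with a prescribed continuous `ℚ`-semialgebraic integrand** (any dimension).
[cite: KontsevichZagier2001, §1.1] -/
theorem exists_cubeRep (N : ℕ) (h : (Fin N → ℝ) → ℝ)
    (hsa : IsSemialgebraicFunOn ℚ (Set.pi Set.univ (fun _ : Fin N => Set.Icc (0:ℝ) 1)) h)
    (hc : ContinuousOn h (Set.pi Set.univ (fun _ : Fin N => Set.Icc (0:ℝ) 1))) :
    ∃ t : IntegralRep N, t.domain = Set.pi Set.univ (fun _ : Fin N => Set.Icc (0:ℝ) 1) ∧ t.integrand = h := by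
  have hS : IsSemialgebraic ℚ (Set.pi Set.univ (fun _ : Fin N => Set.Icc (0:ℝ) 1)) := by
    rw [← cube_eq_pi]; exact isSemialgebraic_cube
  exact ⟨{ domain := Set.pi Set.univ (fun _ : Fin N => Set.Icc (0:ℝ) 1)
           integrand := h
           isSemialgebraic_domain := hS
           isSemialgebraicFunOn_integrand := hsa
           integrableOn := hc.integrableOn_compact (isCompact_univ_pi fun _ => isCompact_Icc) }, rfl, rfl⟩

/-- **S2 absorbs the coordinate transposition of every `K`-rational integrand (rung 9c; lead c5).** For
`P, Q ∈ K[X]` (`K = algebraicClosure ℚ ℝ`) with `Q` zero-free on `[0,1]`, the transposition `P/Q(x₀) − P/Q(x₁)` is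
fibrewise-Stokes decomposable on the square: present `P/Q` as a mixed form (`exists_mixedForm_ratAlgK`) and transpose the
exact part (`stub_exactSwap`), each dlog atom (rung 6, `fibStokesDecomposable_dlogSwap` with `q = p`) and each angular atom
(rung 9b). No value hypothesis, no Baker. [cite: KontsevichZagier2001, §1.2 rule (2)] -/
theorem fibStokesDecomposable_ratSwap (P Q : Polynomial (algebraicClosure ℚ ℝ))
    (hQ : ∀ u ∈ Set.Icc (0:ℝ) 1, (Polynomial.aeval u Q : ℝ) ≠ 0) :
    FibStokesDecomposable 2 (fun z => (Polynomial.aeval (z 0) P : ℝ) / Polynomial.aeval (z 0) Q -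
      (Polynomial.aeval (z 1) P : ℝ) / Polynomial.aeval (z 1) Q) := by
  classical
  obtain ⟨s, pp, cc, s', AA, BB, dd, G₀, g₀, hpp, hcc, hpos, hAA, hBB, hdd, hAB, hG₀, hg₀, hder, hg₀c, hmix⟩ :=
    exists_mixedForm_ratAlgK P Q hQ
  -- exact part
  have hex : FibStokesDecomposable 2 (fun z => g₀ (z 0) - g₀ (z 1)) :=
    stub_exactSwap G₀ g₀ hG₀ hg₀ (fun u hu => (hder u hu).continuousAt.continuousWithinAt) hg₀c
      fun u hu => hder u (Set.Ioo_subset_Icc_self hu)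
  -- dlog atoms (rung 6 with `q = p`)
  have hS2 : IsSemialgebraic ℚ (Set.pi Set.univ (fun _ : Fin 2 => Set.Icc (0:ℝ) 1)) := by
    rw [← cube_eq_pi]; exact isSemialgebraic_cube
  have hdl : ∀ j, FibStokesDecomposable 2 (fun z => cc j * ((Polynomial.derivative (pp j)).eval (z 0) / (pp j).eval (z 0) -
      (Polynomial.derivative (pp j)).eval (z 1) / (pp j).eval (z 1))) := by
    intro j
    set h : (Fin 2 → ℝ) → ℝ := fun z => cc j * ((Polynomial.derivative (pp j)).eval (z 0) / (pp j).eval (z 0) -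
      (Polynomial.derivative (pp j)).eval (z 1) / (pp j).eval (z 1)) with hh
    have hsa : IsSemialgebraicFunOn ℚ (Set.pi Set.univ (fun _ : Fin 2 => Set.Icc (0:ℝ) 1)) h := by
      refine (isSemialgebraicFunOn_const_of_isAlgebraic hS2 (hcc j)).fun_mul (IsSemialgebraicFunOn.fun_sub ?_ ?_)
      · exact (isSemialgebraicFunOn_eval_apply hS2 (isAlgebraic_coeff_derivative (hpp j)) 0).div
          (isSemialgebraicFunOn_eval_apply hS2 (hpp j) 0) fun z hz => (hpos j (z 0) (hz 0 (Set.mem_univ _))).ne'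
      · exact (isSemialgebraicFunOn_eval_apply hS2 (isAlgebraic_coeff_derivative (hpp j)) 1).div
          (isSemialgebraicFunOn_eval_apply hS2 (hpp j) 1) fun z hz => (hpos j (z 1) (hz 1 (Set.mem_univ _))).ne'
    have hcont : ContinuousOn h (Set.pi Set.univ (fun _ : Fin 2 => Set.Icc (0:ℝ) 1)) := by
      refine continuousOn_const.mul (ContinuousOn.sub ?_ ?_)
      · exact ((Polynomial.continuous _).comp (continuous_apply 0)).continuousOn.div
          ((Polynomial.continuous _).comp (continuous_apply 0)).continuousOn
          fun z hz => (hpos j (z 0) (hz 0 (Set.mem_univ _))).ne'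
      · exact ((Polynomial.continuous _).comp (continuous_apply 1)).continuousOn.div
          ((Polynomial.continuous _).comp (continuous_apply 1)).continuousOn
          fun z hz => (hpos j (z 1) (hz 1 (Set.mem_univ _))).ne'
    obtain ⟨t, ht, hti⟩ := exists_cubeRep 2 h hsa hcont
    have := fibStokesDecomposable_dlogSwap (cc j) (pp j) (pp j) (hcc j) (hpp j) (hpp j) (hpos j) (hpos j)
      (mul_comm _ _) t ht (fun z _ => by rw [hti])
    rwa [hti] at this
  -- angular atoms (rung 9b)
  have hang : ∀ k, FibStokesDecomposable 2 (fun z => dd k * (((AA k).eval (z 0) * (Polynomial.derivative (BB k)).eval (z 0) -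
        (Polynomial.derivative (AA k)).eval (z 0) * (BB k).eval (z 0)) / ((AA k).eval (z 0) ^ 2 + (BB k).eval (z 0) ^ 2) -
      ((AA k).eval (z 1) * (Polynomial.derivative (BB k)).eval (z 1) -
        (Polynomial.derivative (AA k)).eval (z 1) * (BB k).eval (z 1)) / ((AA k).eval (z 1) ^ 2 + (BB k).eval (z 1) ^ 2))) :=
    fun k => fibStokesDecomposable_angSwap (dd k) (AA k) (BB k) (hdd k) (hAA k) (hBB k) (hAB k)
  have hsum := fibStokesDecomposable_add 2 _ _ (fibStokesDecomposable_add 2 _ _ hex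
    (fibStokesDecomposable_finsetSum Finset.univ _ fun j _ => hdl j))
    (fibStokesDecomposable_finsetSum Finset.univ _ fun k _ => hang k)
  refine fibStokesDecomposable_congr_off_null 2 _ _ ∅ Literature.ModelTheory.ExponentialFields.isSemialgebraic_empty
    measure_empty (fun z hz _ => ?_) hsum
  rw [hmix (z 0) (hz 0 (Set.mem_univ _)), hmix (z 1) (hz 1 (Set.mem_univ _))]
  simp only [Finset.sum_sub_distrib, mul_sub]
  ring

/-! ## Rung 9d (THEOREM D): separated-variables rational integrands on `[0,1]^N` -/

/-- A `K`-linear combination of `K`-rational functions regular on `[0,1]` is one `K`-rational function regular on `[0,1]`.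
[folklore] -/
theorem exists_ratFun_sum {ι : Type*} [Fintype ι] [DecidableEq ι] (γ : ι → algebraicClosure ℚ ℝ)
    (P Q : ι → Polynomial (algebraicClosure ℚ ℝ))
    (hQ : ∀ j, ∀ u ∈ Set.Icc (0:ℝ) 1, (Polynomial.aeval u (Q j) : ℝ) ≠ 0) :
    ∃ (P₀ Q₀ : Polynomial (algebraicClosure ℚ ℝ)), (∀ u ∈ Set.Icc (0:ℝ) 1, (Polynomial.aeval u Q₀ : ℝ) ≠ 0) ∧
      ∀ u ∈ Set.Icc (0:ℝ) 1, ∑ j, (γ j : ℝ) * ((Polynomial.aeval u (P j) : ℝ) / Polynomial.aeval u (Q j)) =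
        (Polynomial.aeval u P₀ : ℝ) / Polynomial.aeval u Q₀ := by
  suffices H : ∀ (S : Finset ι), ∃ (P₀ Q₀ : Polynomial (algebraicClosure ℚ ℝ)),
      (∀ u ∈ Set.Icc (0:ℝ) 1, (Polynomial.aeval u Q₀ : ℝ) ≠ 0) ∧
      ∀ u ∈ Set.Icc (0:ℝ) 1, ∑ j ∈ S, (γ j : ℝ) * ((Polynomial.aeval u (P j) : ℝ) / Polynomial.aeval u (Q j)) =
        (Polynomial.aeval u P₀ : ℝ) / Polynomial.aeval u Q₀ from H Finset.univ
  intro S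
  induction S using Finset.induction_on with
  | empty => exact ⟨0, 1, fun u _ => by simp, fun u _ => by simp⟩
  | insert j S hj ih =>
    obtain ⟨P₀, Q₀, hQ₀, hsum⟩ := ih
    refine ⟨Polynomial.C (γ j) * P j * Q₀ + P₀ * Q j, Q j * Q₀, fun u hu => ?_, fun u hu => ?_⟩
    · rw [map_mul]; exact mul_ne_zero (hQ j u hu) (hQ₀ u hu)
    · rw [Finset.sum_insert hj, hsum u hu, map_add, map_mul, map_mul, map_mul, map_mul, Polynomial.aeval_C]
      have h1 := hQ j u hu; have h2 := hQ₀ u hu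
      have hγ : (algebraMap (algebraicClosure ℚ ℝ) ℝ) (γ j) = (γ j : ℝ) := rfl
      rw [hγ]
      field_simp

/-- **S2 on the whole separated-variables rational layer (THEOREM D, rung 9d; lead c5).** A closed-cube representation
on `[0,1]^N` with integrand `Σⱼ γⱼ Rⱼ(x_{aⱼ})` — finitely many `K`-rational functions `Rⱼ = Pⱼ/Qⱼ` (`K = algebraicClosure ℚ ℝ`,
`Qⱼ` zero-free on `[0,1]`) of single coordinates, with coefficients `γⱼ ∈ K` — and value `0` is fibrewise-Stokes decomposable:
transpose every `Rⱼ` to one home coordinate (rung 9c, placed by `stub_placeCoords`; each transposition integrates to `0`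
and needs no value hypothesis), and the remainder `(Σⱼ γⱼ Rⱼ)(x_home)` is ONE `K`-rational function of one coordinate of value
`0` (`stub_valueOneCoord`), decomposable by rung 8 (`fibStokesDecomposable_ratAlgK`). Genuinely `N`-dimensional and
Baker-complete. [cite: KontsevichZagier2001, §1.2 Conjecture 1] -/
theorem fibStokesDecomposable_separatedRat {N : ℕ} {ι : Type*} [Fintype ι] (γ : ι → algebraicClosure ℚ ℝ)
    (P Q : ι → Polynomial (algebraicClosure ℚ ℝ)) (a : ι → Fin N)
    (hQ : ∀ j, ∀ u ∈ Set.Icc (0:ℝ) 1, (Polynomial.aeval u (Q j) : ℝ) ≠ 0)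
    (t : IntegralRep N) (ht : t.domain = Set.pi Set.univ (fun _ : Fin N => Set.Icc (0:ℝ) 1))
    (hti : ∀ x ∈ Set.pi Set.univ (fun _ : Fin N => Set.Icc (0:ℝ) 1), t.integrand x =
      ∑ j, (γ j : ℝ) * ((Polynomial.aeval (x (a j)) (P j) : ℝ) / Polynomial.aeval (x (a j)) (Q j)))
    (hv : t.value = 0) : FibStokesDecomposable N t.integrand := by
  classical
  -- no summands: the zero function
  rcases isEmpty_or_nonempty ι with hι | ⟨⟨j₀⟩⟩
  · refine fibStokesDecomposable_congr_off_null N _ _ ∅ Literature.ModelTheory.ExponentialFields.isSemialgebraic_empty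
      measure_empty (fun x hx _ => ?_) (fibStokesDecomposable_zero N)
    rw [hti x hx]; simp
  set home : Fin N := a j₀ with hhome
  set R : ι → ℝ → ℝ := fun j u => (Polynomial.aeval u (P j) : ℝ) / Polynomial.aeval u (Q j) with hR
  have hRc : ∀ j, ContinuousOn (R j) (Set.Icc (0:ℝ) 1) := fun j =>
    (Polynomial.continuous_aeval _).continuousOn.div (Polynomial.continuous_aeval _).continuousOn (hQ j)
  -- the transpositions, placed at `(a j, home)`
  have hT : ∀ j, FibStokesDecomposable N (fun x => (γ j : ℝ) * (R j (x (a j)) - R j (x home))) := by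
    intro j
    by_cases hja : a j = home
    · refine fibStokesDecomposable_congr_off_null N _ _ ∅ Literature.ModelTheory.ExponentialFields.isSemialgebraic_empty
        measure_empty (fun x _ _ => ?_) (fibStokesDecomposable_zero N)
      simp [hja]
    · have h2 : FibStokesDecomposable 2 (fun z => (γ j : ℝ) * (R j (z 0) - R j (z 1))) :=
        fibStokesDecomposable_const_mul 2 (γ j : ℝ) _ (isAlgebraic_coeK _) (fibStokesDecomposable_ratSwap (P j) (Q j) (hQ j))
      have hinj : Function.Injective (![a j, home] : Fin 2 → Fin N) := by
        intro p q hpq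
        fin_cases p <;> fin_cases q
        · rfl
        · simp at hpq; exact absurd hpq hja
        · simp at hpq; exact absurd hpq.symm hja
        · rfl
      have := stub_placeCoords 2 _ h2 N ![a j, home] hinj
      simpa using this
  -- the remainder at the home coordinate
  obtain ⟨P₀, Q₀, hQ₀, hsumR⟩ := exists_ratFun_sum γ P Q hQ
  set R₀ : ℝ → ℝ := fun u => (Polynomial.aeval u P₀ : ℝ) / Polynomial.aeval u Q₀ with hR₀
  have hR₀c : ContinuousOn R₀ (Set.Icc (0:ℝ) 1) :=
    (Polynomial.continuous_aeval _).continuousOn.div (Polynomial.continuous_aeval _).continuousOn hQ₀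
  have hR₀sa : IsSemialgebraicFunOn ℚ (Set.pi Set.univ (fun _ : Fin 1 => Set.Icc (0:ℝ) 1)) (fun z => R₀ (z 0)) :=
    Summit.KontsevichZagierPeriods.HurwitzMicroSectors.NormalFormPrinciple.PiBox.AlgSplitK5.isSemialgebraicFunOn_aevalK_div
      isSemialgebraic_cubePi_one P₀ Q₀ fun z hz => hQ₀ (z 0) (hz 0 (Set.mem_univ _))
  obtain ⟨t₀, ht₀, ht₀i⟩ := exists_cubeRep_one R₀ hR₀sa hR₀c
  -- its value is the value of `t`
  have hmeas : MeasurableSet (Set.pi Set.univ (fun _ : Fin N => Set.Icc (0:ℝ) 1)) :=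
    MeasurableSet.univ_pi fun _ => measurableSet_Icc
  have hint : ∀ j, IntegrableOn (fun x : Fin N → ℝ => (γ j : ℝ) * R j (x (a j)))
      (Set.pi Set.univ (fun _ : Fin N => Set.Icc (0:ℝ) 1)) := fun j =>
    (continuousOn_const.mul ((hRc j).comp (continuous_apply (a j)).continuousOn
      fun x (hx : x ∈ Set.pi Set.univ (fun _ : Fin N => Set.Icc (0:ℝ) 1)) => hx (a j) (Set.mem_univ _))).integrableOn_compact
      (isCompact_univ_pi fun _ => isCompact_Icc)
  have htval : t.value = ∑ j, (γ j : ℝ) * ∫ u in (0:ℝ)..1, R j u := by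
    rw [IntegralRep.value, ht, setIntegral_congr_fun hmeas hti, integral_finsetSum _ fun j _ => hint j]
    refine Finset.sum_congr rfl fun j _ => ?_
    rw [integral_const_mul, setIntegral_cubePi_comp_eval_eq_intervalIntegral (a j) (hRc j)]
  have ht₀v : t₀.value = 0 := by
    rw [value_cubeRep_one_eq_intervalIntegral t₀ R₀ ht₀ (fun z _ => by rw [ht₀i]),
      ← intervalIntegral.integral_congr (f := fun u => ∑ j, (γ j : ℝ) * R j u) (g := R₀)
        (fun u hu => hsumR u (by rwa [Set.uIcc_of_le zero_le_one] at hu)),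
      intervalIntegral.integral_finsetSum fun j _ => ((hRc j).intervalIntegrable_of_Icc zero_le_one).const_mul _]
    simp only [intervalIntegral.integral_const_mul]
    rw [← htval, hv]
  have hdec₀ : FibStokesDecomposable 1 t₀.integrand :=
    fibStokesDecomposable_ratAlgK P₀ Q₀ hQ₀ t₀ ht₀ (fun z _ => by rw [ht₀i]) ht₀v
  have hplace₀ : FibStokesDecomposable N (fun x => R₀ (x home)) := by
    have := stub_placeCoords 1 _ hdec₀ N (fun _ => home) (fun p q _ => Subsingleton.elim p q)
    simpa [ht₀i] using this
  -- assemble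
  have hsum := fibStokesDecomposable_add N _ _ (fibStokesDecomposable_finsetSum Finset.univ _ fun j _ => hT j) hplace₀
  refine fibStokesDecomposable_congr_off_null N _ _ ∅ Literature.ModelTheory.ExponentialFields.isSemialgebraic_empty
    measure_empty (fun x hx _ => ?_) hsum
  have hxh : x home ∈ Set.Icc (0:ℝ) 1 := hx home (Set.mem_univ _)
  rw [hti x hx]
  simp only [hR₀]
  rw [← hsumR (x home) hxh, ← Finset.sum_add_distrib]
  refine Finset.sum_congr rfl fun j _ => ?_
  simp only [hR]
  ring

end General

/-! ## Rung 9e: the kernel conjecture on the separated-variables rational cube sub-calculus -/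

section Kernel

open Summit.KontsevichZagierPeriods.KontsevichZagierPeriods.StokesGenerationLine (exists_liftCube)
open Summit.KontsevichZagierPeriods.HurwitzMicroSectors.NormalFormPrinciple.PiBox.AlgSplitK5 (isAlgebraic_coeK)

/-- Kernel form of THEOREM D for one representation: a closed-cube representation with a separated-variables `K`-rational
integrand and value `0` is a Kontsevich–Zagier relation. [cite: KontsevichZagier2001, §1.2 Conjecture 1] -/
theorem of_mem_relations_separatedRat {N : ℕ} {ι : Type*} [Fintype ι] (γ : ι → algebraicClosure ℚ ℝ)
    (P Q : ι → Polynomial (algebraicClosure ℚ ℝ)) (a : ι → Fin N)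
    (hQ : ∀ j, ∀ u ∈ Set.Icc (0:ℝ) 1, (Polynomial.aeval u (Q j) : ℝ) ≠ 0)
    (t : IntegralRep N) (ht : t.domain = Set.pi Set.univ (fun _ : Fin N => Set.Icc (0:ℝ) 1))
    (hti : ∀ x ∈ Set.pi Set.univ (fun _ : Fin N => Set.Icc (0:ℝ) 1), t.integrand x =
      ∑ j, (γ j : ℝ) * ((Polynomial.aeval (x (a j)) (P j) : ℝ) / Polynomial.aeval (x (a j)) (Q j)))
    (hv : t.value = 0) : of t ∈ relations :=
  of_mem_relations_of_fibStokesDecomposable N t ht (fibStokesDecomposable_separatedRat γ P Q a hQ t ht hti hv)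

/-- **The Kontsevich–Zagier kernel conjecture holds on the separated-variables rational cube sub-calculus (lead c5).**
Every formal `ℤ`-combination of closed-cube representations (of any dimensions) with separated-variables `K`-rational
integrands `Σⱼ γⱼ Pⱼ(x_{aⱼ})/Qⱼ(x_{aⱼ})` (`K = algebraicClosure ℚ ℝ`, `Qⱼ` zero-free on `[0,1]`) whose total value vanishes is a
Kontsevich–Zagier relation: lift all representations to a common dimension by Newton–Leibniz slabs (`exists_liftCube`), merge
them by integrand additivity (`stub_zsmulSumCube`) into ONE separated-variables representation of value `0`, and apply
THEOREM D. An unconditional instance of the crux `StokesGeneration` (kernel form) in every dimension.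
[cite: KontsevichZagier2001, §1.2 Conjecture 1] -/
theorem mem_relations_of_eval_eq_zero_separatedRat :
    ∀ x ∈ AddSubgroup.closure
      {y : FormalRep | ∃ (N k : ℕ) (γ : Fin k → algebraicClosure ℚ ℝ) (P Q : Fin k → Polynomial (algebraicClosure ℚ ℝ))
        (a : Fin k → Fin N) (t : IntegralRep N),
        (∀ j, ∀ u ∈ Set.Icc (0:ℝ) 1, (Polynomial.aeval u (Q j) : ℝ) ≠ 0) ∧
        t.domain = Set.pi Set.univ (fun _ : Fin N => Set.Icc (0:ℝ) 1) ∧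
        (∀ x ∈ Set.pi Set.univ (fun _ : Fin N => Set.Icc (0:ℝ) 1), t.integrand x =
          ∑ j, (γ j : ℝ) * ((Polynomial.aeval (x (a j)) (P j) : ℝ) / Polynomial.aeval (x (a j)) (Q j))) ∧
        y = of t},
      eval x = 0 → x ∈ relations := by
  classical
  intro x hx
  -- every element of the closure is congruent to ONE separated-variables cube representation
  have key : ∃ (N k : ℕ) (γ : Fin k → algebraicClosure ℚ ℝ) (P Q : Fin k → Polynomial (algebraicClosure ℚ ℝ))
      (a : Fin k → Fin N) (t : IntegralRep N),
      (∀ j, ∀ u ∈ Set.Icc (0:ℝ) 1, (Polynomial.aeval u (Q j) : ℝ) ≠ 0) ∧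
      t.domain = Set.pi Set.univ (fun _ : Fin N => Set.Icc (0:ℝ) 1) ∧
      (∀ x ∈ Set.pi Set.univ (fun _ : Fin N => Set.Icc (0:ℝ) 1), t.integrand x =
        ∑ j, (γ j : ℝ) * ((Polynomial.aeval (x (a j)) (P j) : ℝ) / Polynomial.aeval (x (a j)) (Q j))) ∧
      x - of t ∈ relations := by
    induction hx using AddSubgroup.closure_induction with
    | mem y hy =>
      obtain ⟨N, k, γ, P, Q, a, t, hQ, ht, hti, rfl⟩ := hy
      exact ⟨N, k, γ, P, Q, a, t, hQ, ht, hti, by rw [sub_self]; exact relations.zero_mem⟩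
    | zero =>
      obtain ⟨t, ht, hti⟩ := exists_cubeRep 0 (fun _ => 0)
        (isSemialgebraicFunOn_const_of_isAlgebraic (by rw [← cube_eq_pi]; exact isSemialgebraic_cube) isAlgebraic_zero)
        continuousOn_const
      refine ⟨0, 0, Fin.elim0, Fin.elim0, Fin.elim0, Fin.elim0, t, fun j => j.elim0, ht, fun x _ => by simp [hti], ?_⟩
      rw [zero_sub]
      exact relations.neg_mem (of_mem_relations_of_eqOn_zero t fun x _ => by simp [hti])
    | add y z _ _ ihy ihz =>
      obtain ⟨N₁, k₁, γ₁, P₁, Q₁, a₁, t₁, hQ₁, ht₁, hti₁, hrel₁⟩ := ihy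
      obtain ⟨N₂, k₂, γ₂, P₂, Q₂, a₂, t₂, hQ₂, ht₂, hti₂, hrel₂⟩ := ihz
      -- lift both to the dimension `N₁ + N₂`
      have hle₁ : N₁ ≤ N₁ + N₂ := Nat.le_add_right _ _
      have hle₂ : N₂ ≤ N₁ + N₂ := Nat.le_add_left _ _
      obtain ⟨t₁', ht₁', hti₁', hl₁⟩ := exists_liftCube N₁ (N₁ + N₂) hle₁ t₁ ht₁
      obtain ⟨t₂', ht₂', hti₂', hl₂⟩ := exists_liftCube N₂ (N₁ + N₂) hle₂ t₂ ht₂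
      obtain ⟨T, hT, hTi, hmerge⟩ := stub_zsmulSumCube (N₁ + N₂) 2 ![1, 1] ![t₁', t₂'] (fun i => by
        fin_cases i <;> simp [ht₁', ht₂'])
      refine ⟨N₁ + N₂, k₁ + k₂, Fin.append γ₁ γ₂, Fin.append P₁ P₂, Fin.append Q₁ Q₂,
        Fin.append (fun j => Fin.castLE hle₁ (a₁ j)) (fun j => Fin.castLE hle₂ (a₂ j)), T,
        Fin.addCases (fun j => by simpa using hQ₁ j) (fun j => by simpa using hQ₂ j), hT, fun w hw => ?_, ?_⟩
      · have hw₁ : (fun l => w (Fin.castLE hle₁ l)) ∈ Set.pi Set.univ (fun _ : Fin N₁ => Set.Icc (0:ℝ) 1) :=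
          fun l _ => hw _ (Set.mem_univ _)
        have hw₂ : (fun l => w (Fin.castLE hle₂ l)) ∈ Set.pi Set.univ (fun _ : Fin N₂ => Set.Icc (0:ℝ) 1) :=
          fun l _ => hw _ (Set.mem_univ _)
        rw [hTi w hw, Fin.sum_univ_two, Fin.sum_univ_add]
        simp only [Matrix.cons_val_zero, Matrix.cons_val_one, Int.cast_one, one_mul,
          Fin.append_left, Fin.append_right]
        rw [hti₁' w hw, hti₂' w hw, hti₁ _ hw₁, hti₂ _ hw₂]
      · have hsum : (∑ i : Fin 2, (![1, 1] : Fin 2 → ℤ) i • of ((![t₁', t₂'] : Fin 2 → IntegralRep (N₁ + N₂)) i)) =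
            of t₁' + of t₂' := by
          rw [Fin.sum_univ_two]; simp
        rw [hsum] at hmerge
        have : y + z - of T = (y - of t₁) + (z - of t₂) + (of t₁ - of t₁') + (of t₂ - of t₂') +
            (of t₁' + of t₂' - of T) := by abel
        rw [this]
        exact relations.add_mem (relations.add_mem (relations.add_mem (relations.add_mem hrel₁ hrel₂) hl₁) hl₂) hmerge
    | neg y _ ihy =>
      obtain ⟨N, k, γ, P, Q, a, t, hQ, ht, hti, hrel⟩ := ihy
      obtain ⟨T, hT, hTi, hmerge⟩ := stub_zsmulSumCube N 1 ![-1] ![t] (fun i => by fin_cases i; simp [ht])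
      refine ⟨N, k, fun j => -γ j, P, Q, a, T, hQ, hT, fun w hw => ?_, ?_⟩
      · rw [hTi w hw, Fin.sum_univ_one]
        simp only [Matrix.cons_val_zero, Int.cast_neg, Int.cast_one, neg_mul, one_mul]
        rw [hti w hw, ← Finset.sum_neg_distrib]
        refine Finset.sum_congr rfl fun j _ => ?_
        push_cast
        ring
      · have hsum : (∑ i : Fin 1, (![-1] : Fin 1 → ℤ) i • of ((![t] : Fin 1 → IntegralRep N) i)) = -of t := by
          rw [Fin.sum_univ_one]; simp
        rw [hsum] at hmerge
        have : -y - of T = -(y - of t) + (-of t - of T) := by abel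
        rw [this]
        exact relations.add_mem (relations.neg_mem hrel) hmerge
  -- conclude with THEOREM D
  intro h0
  obtain ⟨N, k, γ, P, Q, a, t, hQ, ht, hti, hrel⟩ := key
  have hval : t.value = 0 := by
    have h1 : eval (x - of t) = 0 := relations_le_ker_eval_holds hrel
    rw [map_sub, h0, eval_of, zero_sub, neg_eq_zero] at h1
    exact h1
  have hmem := of_mem_relations_separatedRat γ P Q a hQ t ht hti hval
  have : x = (x - of t) + of t := by abel
  rw [this]
  exact relations.add_mem hrel hmem

end Kernel

end Summit.KontsevichZagierPeriods.KontsevichZagierPeriods.Cruxes.StokesGeneration.FibrewiseStokes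

end
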